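import Mathlib
import HarnessLib
import Summits.HubbardSuperconductivity.HubbardSuperconductivity.Theorems.KLProgrammeKLRegimeTwoVolumeLipGlueTransfer
import Summits.HubbardSuperconductivity.HubbardSuperconductivity.Theorems.KLProgrammeKLRegimeTwoVolumeTransferTailsWt

/-!
# Route `KLProgramme` — crux K3 ENGINE (stmt-HubbardSuperconductivity-20437), stub (e) proof-input «(e)-D-ROWS», G-1: THE NINE GEOMETRY ROWS OF THE CANONICAL
# TRANSFER DOOR FROM TWO Λ-SCALED WEIGHTED SUMS AND BLOCK COVARIANCE
# (seat hubbard-kl-k3c4-p1 g23; `--supports` 20437; DROWS-SCOPE-g23 v5 §9.4 G-1)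

`…TwoVolumeLipGlueTransfer.klGlue_transfer_le` (the deep-pin transfer door at the canonical block structure `klBlockEquiv` / `klBlockEmb` / `klGlue`) reads
NINE geometry data of the fine transfer matrix `T′` (`hcol`, `hwin`, `hρ`, `hrowF`, `hτF`, `hτ₁ … hτ₄`) relative to abstract zone predicates.  Exactly as the
VL spine's end transfer (`…TwoVolumeTowerEndTransfer.tower_keyedDefect_map_transfer_le`, k3c4-p1 g13), all nine follow from TWO Λ-scaled weighted sums of `T′`
(rows and columns with the weight `1 + Λ_T · tnorm(site x − site y′)`, `≤ cW`) and the BLOCK COVARIANCE of `T′` under the canonical structures, by the nine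
lemmas of `…TwoVolumeTransferTailsWt` (`transfer_col_le … transfer_tau4_le`) at the site maps `x ↦ x.1.2`, block index `klBlockEquiv_val`, residue
`klBlockEquiv_snd`; the predicates become distances to the pin: `Near y := tnorm(res w′ − y) ≤ r`, `Z y := 2r < tnorm(res w′ − y)`, `Far y y′ := r < tnorm(y − y′)`,
`NearF y′ := tnorm(w′ − y′) ≤ r`, the pin `(D₀ + r)`-deep with `2r ≤ D₀`, and `a := cW`, `τ := cW / (1 + Λ_T(r+1))`.

* `klGlue_transfer_le_of_wtRows` — the canonical transfer door with the nine rows AND the triangle `Near → Z → Far` discharged; named: the two weighted sums and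
  the block covariance of `T′` (for `T′ = klLipTransfer (bL)` / `klJump (bL)`: E1's weighted overlap rows of `E(F_{J′})·S(F̃_J)` and k3c4-p1 g8's
  `norm_sectorOverlap_blockCovariant`, cf. route A `…TowerTransferWtData`), the periodisation `hP` (discharged at the model by `klLipTransfer_periodise` /
  `klJump_periodise`), the coarse profiles `N`, `N_far` and the defect profiles `E` (pins within `r` of the deep pin), `ND`.

A composition of landed theorems; nothing asserts the (D) rows, stub (e), VL, K3 or superconductivity.
References: BGM 2006 §3 (3.2)–(3.8) [cite: BenfattoGiulianiMastropietro2006].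
-/

namespace Summit.HubbardSuperconductivity.HubbardSuperconductivity.Theorems.TwoVolumeLip

set_option linter.dupNamespace false -- summit = problem name (single-conjunct summit), D-0017

open Finset Literature.MathematicalPhysics.QuantumLattice GrassmannAlgebra Literature.Probability.LatticeModels
open Summit.HubbardSuperconductivity.HubbardSuperconductivity.Theorems.TwoVolumeSource
open Summit.HubbardSuperconductivity.HubbardSuperconductivity.Theorems.TwoVolumeDefect
open Summit.HubbardSuperconductivity.HubbardSuperconductivity.Theorems.TorusFourierL2

noncomputable section

variable {L b M : ℕ} [NeZero L] [NeZero (b * L)]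

set_option maxHeartbeats 400000 in -- the nine transfer data and the door in one declaration
/-- **G-1 — the canonical transfer door from two weighted sums and block covariance.**  For transfer matrices `T′` (fine) and `T` (coarse) related by the
periodisation `hP`, with Λ_T-scaled weighted rows and columns of `T′` at most `cW` and `T′` block covariant under `klBlockEquiv`, at a `(D₀ + r)`-deep output pin
`w′` (`2r ≤ D₀`): `Σ_{X′ p = w′} ‖kernel (map (toLin′ T′) W′ − klGlue (map (toLin′ T) W)) X′‖ ≤ cWⁿ(cW·E + τ·ND) + (2cWⁿτN + n·cWⁿ(5τN + 2cW·N_far))`,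
`τ = cW/(1 + Λ_T(r+1))`, where `N` is the plain and `N_far` the `r`-far pinned profile of `W`, `E` the profile of the defect `W′ − klGlue W` at pins within `r`
of `w′`, `ND` its global profile — `klGlue_transfer_le` with the nine data of `…TwoVolumeTransferTailsWt` and the triangle inequality of `Torus.tnorm`. -/
theorem klGlue_transfer_le_of_wtRows {N₁ N₂ : ℕ} (T' : Matrix (SpaceTimeIdx (b * L) M × SectorLeg N₂) (SpaceTimeIdx (b * L) M × SectorLeg N₁) ℂ)
    (T : Matrix (SpaceTimeIdx L M × SectorLeg N₂) (SpaceTimeIdx L M × SectorLeg N₁) ℂ)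
    (hP : ∀ (X' : SpaceTimeIdx (b * L) M × SectorLeg N₂) (Y : SpaceTimeIdx L M × SectorLeg N₁),
      ∑ Y'' ∈ univ.filter (fun Y'' : SpaceTimeIdx (b * L) M × SectorLeg N₁ => klResLabel L b M N₁ Y'' = Y), T' X' Y'' = T (klResLabel L b M N₂ X') Y)
    {ΛT cW : ℝ} (hΛT : 0 ≤ ΛT) (hcW : 0 ≤ cW)
    (hrow : ∀ x, ∑ y', ‖T' x y'‖ * (1 + ΛT * (Torus.tnorm (x.1.2 - y'.1.2) : ℝ)) ≤ cW)
    (hcol : ∀ y', ∑ x, ‖T' x y'‖ * (1 + ΛT * (Torus.tnorm (x.1.2 - y'.1.2) : ℝ)) ≤ cW)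
    (hcov : ∀ (δ B' B : Fin 2 → Fin b) (xbar : SpaceTimeIdx L M × SectorLeg N₂) (y : SpaceTimeIdx L M × SectorLeg N₁),
      ‖T' ((klBlockEquiv L b M N₂).symm (B' + δ, xbar)) ((klBlockEquiv L b M N₁).symm (B + δ, y))‖ =
        ‖T' ((klBlockEquiv L b M N₂).symm (B', xbar)) ((klBlockEquiv L b M N₁).symm (B, y))‖)
    (W' : GrassmannAlgebra ℂ (SpaceTimeIdx (b * L) M × SectorLeg N₁)) (W : GrassmannAlgebra ℂ (SpaceTimeIdx L M × SectorLeg N₁))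
    {n : ℕ} (p : Fin (n + 1)) (w' : SpaceTimeIdx (b * L) M × SectorLeg N₂) (D₀ r : ℕ) (hD₀ : 2 * r ≤ D₀)
    (hw : ∀ i, D₀ + r ≤ (w'.1.2 i).val % L ∧ (w'.1.2 i).val % L + (D₀ + r) < L)
    {N Nfar E ND : ℝ} (hN0 : 0 ≤ N) (hNfar0 : 0 ≤ Nfar) (hE0 : 0 ≤ E) (hND0 : 0 ≤ ND)
    (hN : ∀ y, ∑ Y ∈ univ.filter (fun Y : Fin (n + 1) → SpaceTimeIdx L M × SectorLeg N₁ => Y p = y), ‖kernel ℂ W (n + 1) Y‖ ≤ N)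
    (hNfar : ∀ y (i : Fin (n + 1)),
      ∑ Y ∈ univ.filter (fun Y : Fin (n + 1) → SpaceTimeIdx L M × SectorLeg N₁ => Y p = y ∧ r < Torus.tnorm ((Y p).1.2 - (Y i).1.2)),
        ‖kernel ℂ W (n + 1) Y‖ ≤ Nfar)
    (hE : ∀ y' : SpaceTimeIdx (b * L) M × SectorLeg N₁, Torus.tnorm (w'.1.2 - y'.1.2) ≤ r →
      ∑ Y' ∈ univ.filter (fun Y' : Fin (n + 1) → SpaceTimeIdx (b * L) M × SectorLeg N₁ => Y' p = y'),
        ‖kernel ℂ (W' - klGlue L b M N₁ W) (n + 1) Y'‖ ≤ E)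
    (hND : ∀ y', ∑ Y' ∈ univ.filter (fun Y' : Fin (n + 1) → SpaceTimeIdx (b * L) M × SectorLeg N₁ => Y' p = y'),
      ‖kernel ℂ (W' - klGlue L b M N₁ W) (n + 1) Y'‖ ≤ ND) :
    ∑ X' ∈ univ.filter (fun X' : Fin (n + 1) → SpaceTimeIdx (b * L) M × SectorLeg N₂ => X' p = w'),
        ‖kernel ℂ (ExteriorAlgebra.map (Matrix.toLin' T') W' - klGlue L b M N₂ (ExteriorAlgebra.map (Matrix.toLin' T) W)) (n + 1) X'‖ ≤
      cW ^ n * (cW * E + cW / (1 + ΛT * ((r : ℝ) + 1)) * ND) +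
        (2 * cW ^ n * (cW / (1 + ΛT * ((r : ℝ) + 1))) * N + n * cW ^ n * (5 * (cW / (1 + ΛT * ((r : ℝ) + 1))) * N + 2 * cW * Nfar)) := by
  classical
  haveI : NeZero b := ⟨fun h => NeZero.ne (b * L) (by rw [h, zero_mul])⟩
  set ed := klBlockEquiv L b M N₂ with hed_def
  set ed₁ := klBlockEquiv L b M N₁ with hed₁_def
  have hed1 : ∀ (x : SpaceTimeIdx (b * L) M × SectorLeg N₂) i, ((ed x).1 i : ℕ) = (x.1.2 i).val / L := fun x i => klBlockEquiv_val L b M _ x i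
  have hed₁1 : ∀ (y' : SpaceTimeIdx (b * L) M × SectorLeg N₁) i, ((ed₁ y').1 i : ℕ) = (y'.1.2 i).val / L := fun y' i => klBlockEquiv_val L b M _ y' i
  have hed2s : ∀ x : SpaceTimeIdx (b * L) M × SectorLeg N₂,
      (fun Y : SpaceTimeIdx L M × SectorLeg N₂ => Y.1.2) (ed x).2 = fun i => ((((x.1.2 i).val : ℕ)) : ZMod L) := fun x => by
    dsimp only; rw [hed_def, klBlockEquiv_snd]
  have hed₁2s : ∀ y' : SpaceTimeIdx (b * L) M × SectorLeg N₁,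
      (fun Y : SpaceTimeIdx L M × SectorLeg N₁ => Y.1.2) (ed₁ y').2 = fun i => ((((y'.1.2 i).val : ℕ)) : ZMod L) := fun y' => by
    dsimp only; rw [hed₁_def, klBlockEquiv_snd]
  -- the nine transfer data (`a := cW`, `τ := cW/(1+Λ_T(r+1))`), regions `R := D₀ + r`, `RN := r`, `RZ := 2r`, `RF := r`
  have hτT : 0 ≤ cW / (1 + ΛT * ((r : ℝ) + 1)) := by positivity
  have hTcol := transfer_col_le (fun x : SpaceTimeIdx (b * L) M × SectorLeg N₂ => x.1.2) (fun y' : SpaceTimeIdx (b * L) M × SectorLeg N₁ => y'.1.2)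
    T' hΛT hcol
  have hTwin := transfer_win_le (fun x : SpaceTimeIdx (b * L) M × SectorLeg N₂ => x.1.2) (fun y' : SpaceTimeIdx (b * L) M × SectorLeg N₁ => y'.1.2)
    T' hΛT hcol ed ed₁ hcov
  have hTρ := transfer_rho_le (fun x : SpaceTimeIdx (b * L) M × SectorLeg N₂ => x.1.2) (fun y' : SpaceTimeIdx (b * L) M × SectorLeg N₁ => y'.1.2)
    T' hΛT hrow ed ed₁
  have hTrowF := transfer_rowF_le (fun x : SpaceTimeIdx (b * L) M × SectorLeg N₂ => x.1.2) (fun y' : SpaceTimeIdx (b * L) M × SectorLeg N₁ => y'.1.2)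
    T' hΛT hrow r
  have hTτF := transfer_tauF_le (fun x : SpaceTimeIdx (b * L) M × SectorLeg N₂ => x.1.2) (fun y' : SpaceTimeIdx (b * L) M × SectorLeg N₁ => y'.1.2)
    T' hΛT hrow hcW (le_refl r)
  have hTτ2 := transfer_tau2_le (fun x : SpaceTimeIdx (b * L) M × SectorLeg N₂ => x.1.2) (fun y' : SpaceTimeIdx (b * L) M × SectorLeg N₁ => y'.1.2)
    T' hΛT hrow hcW (rfl : b * L = b * L) ed ed₁ hed1 hed₁1 (Nat.le_add_left r D₀) w' hw
  have hTτ3 := transfer_tau3_le (fun x : SpaceTimeIdx (b * L) M × SectorLeg N₂ => x.1.2) (fun y' : SpaceTimeIdx (b * L) M × SectorLeg N₁ => y'.1.2)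
    T' hΛT hrow hcW (rfl : b * L = b * L) ed ed₁ (fun Y : SpaceTimeIdx L M × SectorLeg N₂ => Y.1.2) (fun Y : SpaceTimeIdx L M × SectorLeg N₁ => Y.1.2)
    hed2s hed₁2s (le_refl r) w'
  have hTτ1 := transfer_tau1_le (fun x : SpaceTimeIdx (b * L) M × SectorLeg N₂ => x.1.2) (fun y' : SpaceTimeIdx (b * L) M × SectorLeg N₁ => y'.1.2)
    T' hΛT hcol (rfl : b * L = b * L) ed ed₁ hed1 hed₁1 (fun Y : SpaceTimeIdx L M × SectorLeg N₂ => Y.1.2)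
    (fun Y : SpaceTimeIdx L M × SectorLeg N₁ => Y.1.2) hed2s hed₁2s (RZ := 2 * r) (by omega : r + 2 * r ≤ D₀ + r) w' hw
  have hTτ4 := transfer_tau4_le (fun x : SpaceTimeIdx (b * L) M × SectorLeg N₂ => x.1.2) (fun y' : SpaceTimeIdx (b * L) M × SectorLeg N₁ => y'.1.2)
    T' hΛT hcol (rfl : b * L = b * L) ed ed₁ hed1 hed₁1 (fun Y : SpaceTimeIdx L M × SectorLeg N₂ => Y.1.2)
    (fun Y : SpaceTimeIdx L M × SectorLeg N₁ => Y.1.2) hed2s hed₁2s hcov (RZ := 2 * r) (by omega : r + 2 * r ≤ D₀ + r) w' hw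
  -- the triangle `Near y → Z y′ → Far y y′`
  have hZT : ∀ y y' : SpaceTimeIdx L M × SectorLeg N₁, Torus.tnorm ((ed w').2.1.2 - y.1.2) ≤ r → 2 * r < Torus.tnorm ((ed w').2.1.2 - y'.1.2) →
      r < Torus.tnorm (y.1.2 - y'.1.2) := by
    intro y y' hy hy'
    have htri := Torus.tnorm_add_le ((ed w').2.1.2 - y.1.2) (y.1.2 - y'.1.2)
    rw [sub_add_sub_cancel] at htri; omega
  exact klGlue_transfer_le T' T hP W' W p w' (fun y => 2 * r < Torus.tnorm ((ed w').2.1.2 - y.1.2))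
    (fun y => Torus.tnorm ((ed w').2.1.2 - y.1.2) ≤ r) (fun y y' => r < Torus.tnorm (y.1.2 - y'.1.2)) hZT
    (fun y' => Torus.tnorm (w'.1.2 - y'.1.2) ≤ r) hcW hτT hN0 hNfar0 hE0 hND0 hTcol hTwin (hTρ w') (hTrowF w') (hTτF w')
    (fun y hy => hTτ1 y hy) hTτ2 (hTτ3) (fun y hy => hTτ4 y hy) hN hNfar hE hND

end

end Summit.HubbardSuperconductivity.HubbardSuperconductivity.Theorems.TwoVolumeLip
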